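import Summits.SmoothPoincare4.SmoothPoincare4.Theorems.EntropyRungSubcylindricalExistenceAnnulusConeFloorFar
import Mathlib.Geometry.Euclidean.Inversion.Calculus
import Mathlib.MeasureTheory.Function.Jacobian
import Mathlib.Analysis.InnerProductSpace.Projection.FiniteDimensional
import HarnessLib

/-!
# The exact-cone annulus floor in the inverted picture (stub `helper_annulusConeFloor`, W3b of
# line `fat-conical-core-avr-logsobolev`, crux `EntropyRung.SubcylindricalExistence`,
# stmt-SmoothPoincare4-10871)

The cone metric `Λ'² δ`, `Λ'(z) = c'‖z‖^{−(c'+1)}`, on `ℝ⁴ ∖ {0}` is the exact cone of slope `c'`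
over the round `S³` written with its large end at `z → 0` and its vertex at `z = ∞`; the inversion
`ι(x) = x/‖x‖²` (Mathlib's `EuclideanGeometry.inversion 0 1`, an involution of `ℝ⁴ ∖ {0}` with
`‖ι x‖ = ‖x‖⁻¹`, `Dι_x = ‖x‖⁻² · (reflection)`, `|det Dι_x| = ‖x‖⁻⁸`) pulls it back to the cone
`(c'‖x‖^{c'−1})² δ` with vertex at the origin. Transporting Perelman's `𝒲`-clause in `w²`-form
along `ι` — Lebesgue change of variables `∫ G(z) dz = ∫ ‖x‖⁻⁸ G(ι x) dx`
(`MeasureTheory.integral_image_eq_integral_abs_det_fderiv_smul`) and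
`‖∇(v ∘ ι)(x)‖ = ‖x‖⁻² ‖(∇v)(ι x)‖` (the reflection is an isometry) — the `x`-picture floor
`helper_helper_annulusConeFloor_cone` (Balogh–Kristály–Tripaldi on the smoothed cone model, both
hypotheses) becomes the registered statement: for `v` smooth with
`tsupport v ⊆ {ρ₁ < ‖z‖ < ρ₂}` and `∫ (4πτ)⁻² v² Λ'⁴ dz = 1`,
`3 log c' ≤ ∫ [4τ Λ'⁻² ‖∇v‖² − v² log v² − 4 v²] (4πτ)⁻² Λ'⁴ dz`.
Everything is proved; no definition, no named fact.

References: Z. M. Balogh, A. Kristály, F. Tripaldi, J. Funct. Anal. 286 (2024), Thm. 1.1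
[BaloghKristalyTripaldi2024]; G. Perelman, arXiv:math/0211159, §3.1 [Perelman2002Entropy];
H. Federer, *Geometric Measure Theory* (1969), §3.2.3, §3.2.5 [Federer1969].
-/

noncomputable section

open scoped Manifold ContDiff Topology ENNReal NNReal RealInnerProductSpace
open Set Filter Function MeasureTheory InnerProductSpace EuclideanGeometry
open Literature.Geometry.Lorentzian

-- the registered namespace `Summit.SmoothPoincare4.SmoothPoincare4.Theorems` repeats a component
set_option linter.dupNamespace false

namespace Summit.SmoothPoincare4.SmoothPoincare4.Theorems

namespace AnnulusConeFloor

/-! ## The inversion `ι(x) = x/‖x‖²` of `ℝ⁴`: norm, involution, Jacobian, gradient -/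

/-- `‖ι x‖ = ‖x‖⁻¹` (also at the junk value `ι 0 = 0`). [folklore] -/
theorem norm_inversion (x : EuclideanSpace ℝ (Fin 4)) :
    ‖inversion (0 : EuclideanSpace ℝ (Fin 4)) 1 x‖ = ‖x‖⁻¹ := by
  have h := dist_inversion_center (0 : EuclideanSpace ℝ (Fin 4)) x 1
  rw [dist_zero_right, dist_zero_right, one_pow, one_div] at h
  exact h

/-- `ι` is an involution. [folklore] -/
theorem inversion_inversion_self (x : EuclideanSpace ℝ (Fin 4)) :
    inversion (0 : EuclideanSpace ℝ (Fin 4)) 1 (inversion (0 : EuclideanSpace ℝ (Fin 4)) 1 x) = x :=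
  inversion_inversion 0 one_ne_zero x

/-- `ι x = 0 ↔ x = 0`. [folklore] -/
theorem inversion_eq_zero_iff (x : EuclideanSpace ℝ (Fin 4)) :
    inversion (0 : EuclideanSpace ℝ (Fin 4)) 1 x = 0 ↔ x = 0 :=
  inversion_eq_center one_ne_zero

/-- **The Jacobian of the inversion**: `|det Dι_x| = ‖x‖⁻⁸`, `Dι_x = ‖x‖⁻² · reflection`
(`EuclideanGeometry.hasFDerivAt_inversion`, `Submodule.det_reflection = ±1`).
[cite: Federer1969, §3.2.3] -/
theorem abs_det_fderiv_inversion (x : EuclideanSpace ℝ (Fin 4)) :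
    |((1 / dist x (0 : EuclideanSpace ℝ (Fin 4))) ^ 2 •
        ((ℝ ∙ (x - 0))ᗮ.reflection : EuclideanSpace ℝ (Fin 4) →L[ℝ] EuclideanSpace ℝ (Fin 4))).det| =
      ‖x‖⁻¹ ^ 8 := by
  rw [ContinuousLinearMap.det, ContinuousLinearMap.toLinearMap_smul, LinearMap.det_smul,
    finrank_euclideanSpace_fin]
  have hdet : LinearMap.det (((ℝ ∙ (x - 0))ᗮ.reflection :
      EuclideanSpace ℝ (Fin 4) →L[ℝ] EuclideanSpace ℝ (Fin 4)) :
        EuclideanSpace ℝ (Fin 4) →ₗ[ℝ] EuclideanSpace ℝ (Fin 4)) =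
      (-1) ^ Module.finrank ℝ ((ℝ ∙ (x - 0))ᗮᗮ) := by
    rw [← Submodule.det_reflection]
    rfl
  rw [hdet, abs_mul, abs_pow, abs_pow, abs_pow, abs_neg, abs_one, one_pow, mul_one, dist_zero_right,
    one_div, abs_of_nonneg (inv_nonneg.2 (norm_nonneg _)), ← pow_mul]

/-- **Change of variables under the inversion**: `∫ G(z) dz = ∫ ‖x‖⁻⁸ G(ι x) dx` for every `G`
(`integral_image_eq_integral_abs_det_fderiv_smul` on the co-null set `{0}ᶜ`, which `ι` maps
injectively onto itself). [cite: Federer1969, §3.2.5] -/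
theorem integral_comp_inversion (G : EuclideanSpace ℝ (Fin 4) → ℝ) :
    ∫ z, G z = ∫ x, ‖x‖⁻¹ ^ 8 * G (inversion (0 : EuclideanSpace ℝ (Fin 4)) 1 x) := by
  set s : Set (EuclideanSpace ℝ (Fin 4)) := {0}ᶜ with hs
  have hsm : MeasurableSet s := (measurableSet_singleton 0).compl
  have hderiv : ∀ x ∈ s, HasFDerivWithinAt (inversion (0 : EuclideanSpace ℝ (Fin 4)) 1)
      ((1 / dist x (0 : EuclideanSpace ℝ (Fin 4))) ^ 2 •
        ((ℝ ∙ (x - 0))ᗮ.reflection : EuclideanSpace ℝ (Fin 4) →L[ℝ] EuclideanSpace ℝ (Fin 4))) s x :=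
    fun x hx ↦ (hasFDerivAt_inversion (R := 1) hx).hasFDerivWithinAt
  have hinj : InjOn (inversion (0 : EuclideanSpace ℝ (Fin 4)) 1) s :=
    (inversion_injective 0 one_ne_zero).injOn
  have himage : inversion (0 : EuclideanSpace ℝ (Fin 4)) 1 '' s = s := by
    refine Subset.antisymm ?_ fun x hx ↦ ⟨_, ?_, inversion_inversion_self x⟩
    · rintro _ ⟨x, hx, rfl⟩
      rw [hs, mem_compl_singleton_iff] at hx ⊢
      exact fun h ↦ hx ((inversion_eq_zero_iff x).1 h)
    · rw [hs, mem_compl_singleton_iff] at hx ⊢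
      intro h
      apply hx
      rw [← inversion_inversion_self x, h, inversion_self]
  have key := integral_image_eq_integral_abs_det_fderiv_smul volume hsm hderiv hinj G
  rw [himage, restrict_compl_singleton] at key
  rw [key]
  refine integral_congr_ae (ae_of_all _ fun x ↦ ?_)
  beta_reduce
  rw [abs_det_fderiv_inversion x, smul_eq_mul]

/-- **The gradient under the inversion**: `‖∇(v ∘ ι)(x)‖ = ‖x‖⁻² ‖(∇v)(ι x)‖` for `x ≠ 0`
(chain rule; `Dι_x = ‖x‖⁻² ·` an isometric reflection). [folklore] -/
theorem norm_gradient_comp_inversion {v : EuclideanSpace ℝ (Fin 4) → ℝ} (hv : Differentiable ℝ v)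
    {x : EuclideanSpace ℝ (Fin 4)} (hx : x ≠ 0) :
    ‖gradient (fun y ↦ v (inversion (0 : EuclideanSpace ℝ (Fin 4)) 1 y)) x‖ =
      ‖x‖⁻¹ ^ 2 * ‖gradient v (inversion (0 : EuclideanSpace ℝ (Fin 4)) 1 x)‖ := by
  have hι := hasFDerivAt_inversion (c := (0 : EuclideanSpace ℝ (Fin 4))) (R := 1) hx
  have hcomp := (hv (inversion (0 : EuclideanSpace ℝ (Fin 4)) 1 x)).hasFDerivAt.comp x hι
  have hf : (fun y ↦ v (inversion (0 : EuclideanSpace ℝ (Fin 4)) 1 y)) =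
      v ∘ inversion (0 : EuclideanSpace ℝ (Fin 4)) 1 := rfl
  rw [hf, gradient, hcomp.fderiv, LinearIsometryEquiv.norm_map, ContinuousLinearMap.comp_smul,
    norm_smul, gradient, LinearIsometryEquiv.norm_map, dist_zero_right, one_div,
    Real.norm_of_nonneg (by positivity)]
  congr 1
  exact ContinuousLinearMap.opNorm_comp_linearIsometryEquiv _ _

/-- The inverted cone weight: `(c' ‖ι x‖^{−(c'+1)}) = c' ‖x‖^{c'−1} ‖x‖²` for `x ≠ 0`. [folklore] -/
theorem coneWeight_inversion {c' : ℝ} {x : EuclideanSpace ℝ (Fin 4)} (hx : x ≠ 0) :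
    c' * ‖inversion (0 : EuclideanSpace ℝ (Fin 4)) 1 x‖ ^ (-(c' + 1)) =
      c' * ‖x‖ ^ (c' - 1) * ‖x‖ ^ 2 := by
  have hn : 0 < ‖x‖ := norm_pos_iff.2 hx
  rw [norm_inversion, Real.inv_rpow hn.le, Real.rpow_neg hn.le, inv_inv,
    show c' + 1 = (c' - 1) + 2 by ring, Real.rpow_add hn, Real.rpow_two, mul_assoc]

end AnnulusConeFloor

open AnnulusConeFloor in
/-- **W3b — the exact-cone annulus floor (registered stub `helper_annulusConeFloor` of line
`fat-conical-core-avr-logsobolev`).** BKT (scale-family form, hypothesis) + the smoothed cone model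
(hypothesis) ⇒ in the inverted picture `Λ' = c'‖z‖^{−(c'+1)}` on `ℝ⁴` (large end at the origin),
for every `c' ∈ (0, 1]`, `0 < ρ₁ < ρ₂`, `τ > 0` and `v ∈ C^∞(ℝ⁴)` with
`tsupport v ⊆ {ρ₁ < ‖z‖ < ρ₂}` and `∫ (4πτ)⁻² v² Λ'⁴ dz = 1`:
`3 log c' ≤ ∫ [4τ Λ'⁻² ‖∇v‖² − v² log v² − 4 v²] (4πτ)⁻² Λ'⁴ dz` — the `x`-picture floor
`helper_helper_annulusConeFloor_cone` for `u = v ∘ ι` transported along the inversion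
`ι(x) = x/‖x‖²` (`dz = ‖x‖⁻⁸ dx`, `‖∇v‖(ι x) = ‖x‖² ‖∇u(x)‖`, `Λ'(ι x) = c'‖x‖^{c'+1}`).
[cite: BaloghKristalyTripaldi2024, Thm. 1.1] -/
theorem helper_annulusConeFloor : (∀ (P : Type) [TopologicalSpace P] [T2Space P] [SecondCountableTopology P]
      [ChartedSpace (EuclideanSpace ℝ (Fin 4)) P] [IsManifold (𝓡 4) ∞ P] [ConnectedSpace P]
      [T3Space P] [MeasurableSpace P] [BorelSpace P]
      (h : PseudoRiemannianMetric (𝓡 4) ∞ (EuclideanSpace ℝ (Fin 4)) (TangentSpace (𝓡 4) : P → Type _))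
      [h.HasLeviCivita] (hh : h.IsRiemannian) (θ : ℝ),
      (∀ (x : P) (r : NNReal), IsCompact {y : P | h.edist hh x y ≤ r}) →
      (∀ (x : P) (X : TangentSpace (𝓡 4) x), 0 ≤ h.ricci x X X) → 0 < θ →
      (∀ x : P, Tendsto (fun r : ℝ ↦
        ((riemannianMeasure (h.toContMDiffRiemannianMetric hh))
          {y : P | h.edist hh x y ≤ ENNReal.ofReal r}).toReal / (Real.pi ^ 2 / 2 * r ^ 4))
        atTop (𝓝 θ)) →
      ∀ u : P → ℝ, ContMDiff (𝓡 4) 𝓘(ℝ, ℝ) ∞ u → HasCompactSupport u →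
        ∫ x, (u x) ^ 2 ∂(riemannianMeasure (h.toContMDiffRiemannianMetric hh)) = 1 →
        ∀ τ : ℝ, 0 < τ →
          ∫ x, (u x) ^ 2 * Real.log ((u x) ^ 2) ∂(riemannianMeasure (h.toContMDiffRiemannianMetric hh)) ≤
            4 * τ * ∫ x, h.gradSq u x ∂(riemannianMeasure (h.toContMDiffRiemannianMetric hh))
              - Real.log θ - 2 * Real.log (4 * Real.pi * τ) - 4) →
    (∀ c' : ℝ, 0 < c' → c' ≤ 1 →
      ∃ gc : PseudoRiemannianMetric (𝓡 4) ∞ (EuclideanSpace ℝ (Fin 4))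
          (TangentSpace (𝓡 4) : EuclideanSpace ℝ (Fin 4) → Type _),
      ∃ _ : gc.HasLeviCivita, ∃ hgc : gc.IsRiemannian,
        (∀ (x : EuclideanSpace ℝ (Fin 4)) (r : NNReal),
          IsCompact {y : EuclideanSpace ℝ (Fin 4) | gc.edist hgc x y ≤ r}) ∧
        (∀ (x : EuclideanSpace ℝ (Fin 4)) (X : TangentSpace (𝓡 4) x), 0 ≤ gc.ricci x X X) ∧
        (∀ x : EuclideanSpace ℝ (Fin 4), Tendsto (fun r : ℝ ↦
          ((riemannianMeasure (gc.toContMDiffRiemannianMetric hgc))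
            {y : EuclideanSpace ℝ (Fin 4) | gc.edist hgc x y ≤ ENNReal.ofReal r}).toReal /
              (Real.pi ^ 2 / 2 * r ^ 4)) atTop (𝓝 (c' ^ 3))) ∧
        ∀ x : EuclideanSpace ℝ (Fin 4), 1 ≤ ‖x‖ → ∀ v w : EuclideanSpace ℝ (Fin 4),
          gc.val x v w = (c' * ‖x‖ ^ (c' - 1)) ^ 2 * ⟪v, w⟫) →
    ∀ c' : ℝ, 0 < c' → c' ≤ 1 → ∀ ρ₁ ρ₂ : ℝ, 0 < ρ₁ → ρ₁ < ρ₂ → ∀ τ : ℝ, 0 < τ →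
      ∀ v : EuclideanSpace ℝ (Fin 4) → ℝ, ContDiff ℝ ∞ v →
        tsupport v ⊆ {z | ρ₁ < ‖z‖ ∧ ‖z‖ < ρ₂} →
        ∫ z, (4 * Real.pi * τ) ^ (-(4 : ℝ) / 2) * (v z) ^ 2 * (c' * ‖z‖ ^ (-(c' + 1))) ^ 4 = 1 →
          3 * Real.log c' ≤
            ∫ z, (4 * τ * ((c' * ‖z‖ ^ (-(c' + 1)))⁻¹ ^ 2 * ‖gradient v z‖ ^ 2)
                - (v z) ^ 2 * Real.log ((v z) ^ 2) - 4 * (v z) ^ 2)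
                * ((4 * Real.pi * τ) ^ (-(4 : ℝ) / 2) * (c' * ‖z‖ ^ (-(c' + 1))) ^ 4) := by
  intro hBKT hmodel c' hc' hc1 ρ₁ ρ₂ hρ₁ hρ₁₂ τ hτ v hv hvs hnorm
  have hρ₂ : 0 < ρ₂ := hρ₁.trans hρ₁₂
  have hv0 : ∀ z, v z ≠ 0 → ρ₁ < ‖z‖ ∧ ‖z‖ < ρ₂ := fun z hz ↦ hvs (subset_tsupport _ (mem_support.2 hz))
  -- the transported function `u = v ∘ ι` and its support
  set u : EuclideanSpace ℝ (Fin 4) → ℝ := fun x ↦ v (inversion (0 : EuclideanSpace ℝ (Fin 4)) 1 x)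
    with hu_def
  have hu0 : ∀ x, u x ≠ 0 → ρ₂⁻¹ < ‖x‖ ∧ ‖x‖ < ρ₁⁻¹ := by
    intro x hx
    obtain ⟨h1, h2⟩ := hv0 _ hx
    rw [norm_inversion] at h1 h2
    have hx0 : 0 < ‖x‖ := by
      rcases (norm_nonneg x).eq_or_lt with h | h
      · rw [← h, inv_zero] at h1
        linarith
      · exact h
    exact ⟨inv_lt_of_inv_lt₀ hx0 h2, lt_inv_of_lt_inv₀ hρ₁ h1⟩
  have hu00 : u 0 = 0 := by
    by_contra h
    have := (hu0 0 h).1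
    rw [norm_zero] at this
    linarith [inv_pos.2 hρ₂]
  have hus : tsupport u ⊆ {x | ρ₂⁻¹ ≤ ‖x‖} :=
    closure_minimal (fun x hx ↦ (hu0 x hx).1.le) (isClosed_le continuous_const continuous_norm)
  have h0t : (0 : EuclideanSpace ℝ (Fin 4)) ∉ tsupport u := fun h ↦ by
    have := hus h
    rw [mem_setOf_eq, norm_zero] at this
    linarith [inv_pos.2 hρ₂]
  have huc : HasCompactSupport u := by
    refine HasCompactSupport.intro (isCompact_closedBall (0 : EuclideanSpace ℝ (Fin 4)) ρ₁⁻¹)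
      fun x hx ↦ ?_
    by_contra h
    exact hx (Metric.mem_closedBall.2 (by rw [dist_zero_right]; exact (hu0 x h).2.le))
  have hu : ContDiff ℝ ∞ u := by
    rw [contDiff_iff_contDiffAt]
    intro x
    by_cases hx : x = 0
    · subst hx
      exact (contDiffAt_const (c := (0 : ℝ))).congr_of_eventuallyEq
        (notMem_tsupport_iff_eventuallyEq.mp h0t)
    · exact hv.contDiffAt.comp x (contDiffAt_const.inversion contDiffAt_const contDiffAt_id hx)
  -- the normalisation transported to the `x`-picture
  have hnorm_u : ∫ x, (4 * Real.pi * τ) ^ (-(4 : ℝ) / 2) * (u x) ^ 2 * (c' * ‖x‖ ^ (c' - 1)) ^ 4 = 1 := by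
    rw [integral_comp_inversion] at hnorm
    refine (integral_congr_ae (ae_of_all _ fun x ↦ ?_)).trans hnorm
    beta_reduce
    by_cases hx : x = 0
    · subst hx
      rw [hu00]
      simp
    · have hn : ‖x‖ ≠ 0 := norm_ne_zero_iff.2 hx
      rw [coneWeight_inversion hx, hu_def]
      field_simp
  -- the `x`-picture floor for `u`
  have key := helper_helper_annulusConeFloor_cone hBKT hmodel c' hc' hc1 ρ₂⁻¹ (inv_pos.2 hρ₂) τ hτ u hu
    huc hus hnorm_u
  -- transported back along the inversion
  rw [integral_comp_inversion]
  refine key.trans_eq (integral_congr_ae (ae_of_all _ fun x ↦ ?_))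
  beta_reduce
  by_cases hx : x = 0
  · subst hx
    rw [CapClauseEuclideanSchwarzschildAux.gradient_eq_zero_of_notMem h0t, hu00]
    simp
  · have hn : ‖x‖ ≠ 0 := norm_ne_zero_iff.2 hx
    have hR : ‖x‖ ^ (c' - 1) ≠ 0 := (Real.rpow_pos_of_pos (norm_pos_iff.2 hx) _).ne'
    have hc0 : c' ≠ 0 := hc'.ne'
    rw [coneWeight_inversion hx, hu_def, norm_gradient_comp_inversion (hv.differentiable (by simp)) hx]
    field_simp

end Summit.SmoothPoincare4.SmoothPoincare4.Theorems

end
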